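import Literature.NumberTheory.DiophantineGeometry.AVGaloisModule
import Literature.NumberTheory.EllipticCurves.TateModuleContinuityProofs
import Literature.AlgebraicGeometry.Motives.AbelianVarietyLie
import Mathlib.FieldTheory.Minpoly.Field
import Mathlib.FieldTheory.KrullTopology
import HarnessLib

/-!
# Continuity of the Galois action on `V_ℓ A`; finiteness of `A[n](K̄)` and of `T_ℓ A` (proofs for `AVGaloisModule`)

Pure-proof sibling of `Literature.NumberTheory.DiophantineGeometry.AVGaloisModule`, which records
as named facts (D-0014), for an abelian variety `A` over a field `K` and a prime `ℓ`,

* `AbelianVariety.continuous_rationalTateRep A ℓ` — for `ℓ` invertible in `K`, the Galois action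
  `Γ_K × V_ℓ A → V_ℓ A` is jointly continuous for the Krull topology on `Γ_K = Gal(K̄/K)` and the
  `ℚ_ℓ`-module topology on `V_ℓ A = ℚ_ℓ ⊗_{ℤ_ℓ} T_ℓ A`;
* `AbelianVariety.module_free_tateModule A ℓ` — for `ℓ` invertible in `K`, `T_ℓ A` is a free
  `ℤ_ℓ`-module;

both **discharged here unconditionally** (`continuous_rationalTateRep_holds`,
`module_free_tateModule_holds`), together with the unconditional finiteness of the `n`-torsion
`A[n](L)` for `n` invertible in `K` and any field `L ⊇ K` (`finite_torsionPoints_of_cast_ne_zero`,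
`finite_geomTorsion_of_cast_ne_zero`) and of `T_ℓ A` over `ℤ_ℓ` for `ℓ ≠ char K`
(`module_finite_tateModule_of_cast_ne_zero`). The named fact `module_finite_tateModule A ℓ`
(no restriction on `ℓ`) is reduced to `isIsogeny_zsmul_id A` (`[n]_A` an isogeny for all `n ≠ 0`,
theorem of the cube), which covers `ℓ = char K` (`module_finite_tateModule_of_isIsogeny_zsmul_id`).

Finally (section `FinrankBridge`), since `T_ℓ A` is free over `ℤ_ℓ` for `ℓ ≠ char K`,
`dim_{ℚ_ℓ} V_ℓ A = rank_{ℤ_ℓ} T_ℓ A` unconditionally (`finrank_rationalTateModule_eq_finrank_tateModule`,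
Mathlib `Module.finrank_baseChange`), so the two named facts `finrank_rationalTateModule_eq A ℓ`
(`dim_{ℚ_ℓ} V_ℓ A = 2 dim A`, Mumford §19, p. 172) and `finrank_tateModule_eq A ℓ`
(`rank_{ℤ_ℓ} T_ℓ A = 2 dim A`, Serre–Tate 1968, §1, p. 493) are **equivalent**
(`finrank_rationalTateModule_eq_iff_finrank_tateModule_eq`): the former is not a separate proof
obligation — its discharge is `finrank_rationalTateModule_eq_of_finrank_tateModule_eq` applied to a
discharge of the latter (both being, in the tree, proved consequences of the single named fact
`cechComplex_pseudoCoherent_general`, file `AVGaloisModuleTateRankOfCubeProofs`).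

## Sources

* J.-P. Serre, J. Tate, *Good reduction of abelian varieties*, Ann. of Math. (2) 88 (1968), §1,
  p. 493: for `l ≠ char(K)`, "`T_l(A) = inv lim A_{lⁿ}` [...] is a free module of rank `2 dim(A)`
  over the ring `Z_l`"; "the group `Gal(K_s/K)` acts continuously on `T_l(A)`", and on
  `V_l(A) = T_l(A) ⊗ Q_l`, the `l`-adic representation `ρ_l`. [SerreTate1968]
* J.-P. Serre, *Abelian ℓ-adic representations and elliptic curves* (1968), Ch. I §1.1 (an
  `ℓ`-adic representation is a *continuous* homomorphism `Gal(K̄/K) → Aut(V)`) and §1.2,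
  Example 2 (abelian varieties: "one checks easily that this is an `ℓ`-adic representation").
  [SerreAbelianLadic1968]
* U. Görtz, T. Wedhorn, *Algebraic Geometry II* (2023), Prop. 27.187 (`[n]_A` is finite étale,
  hence an isogeny, for `n` invertible), (27.35.2) (`X[n](T) = {x ∈ X(T); nx = 0}`),
  Cor. 27.177 (1) (kernels of isogenies are finite). [GortzWedhorn2023]
* D. Mumford, *Abelian Varieties* (1970), §6, Application 3, Proposition p. 64 (`A[n]` finite);
  §19, p. 171 (`T_ℓ A ≅ ℤ_ℓ^{2g}`). [MumfordAV1970]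

## Proof architecture (the printed "one checks easily", made explicit)

1. `finite_specHom_of_isFinite`: a finite `K`-scheme `G = Spec H` has finitely many `L`-points
   over `K` for any field `L ⊇ K` — they are the `K`-algebra maps `H → L`
   (`specHomEquivUnderHom`, `underHomEquivAlgHom` of `AbelianVarietyTorsion`), finitely many since
   `dim_K H < ∞` (Mathlib `minpoly.AlgHom.fintype`).
2. `finite_torsionPoints_of_isIsogeny_zsmul`: if `[n]_A` is an isogeny, `A[n](L) = (Ker [n]_A)(L)`
   (`torsionPoints_eq_kerPoints`, `Hom.kerPointsEquiv`) is finite by 1, `Ker [n]_A → Spec K` being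
   finite (base change). For `n` invertible in `K`, `[n]_A` **is** an isogeny — the tree's
   theorem `isIsogeny_zsmul_id_of_cast_ne_zero` (`AbelianVarietyLie`: `Lie([n]) = n`, so `[n]` is
   étale, and étale homomorphisms of abelian varieties are finite surjective):
   `finite_torsionPoints_of_cast_ne_zero`, `finite_geomTorsion_of_cast_ne_zero`.
3. `A[ℓ](K̄)` finite ⇒ `T_ℓ A` finitely generated and free over `ℤ_ℓ`
   (`TateModule.finite_of_finite_torsionBy`, `free_of_finite_torsionBy` of `TateModuleFree`:
   Nakayama for the `ℓ`-adically separated `T_ℓ` with `T_ℓ/ℓ ↪ A[ℓ]`, torsion-free over a PID):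
   `module_finite_tateModule_of_cast_ne_zero`, `module_free_tateModule_holds`.
4. `continuous_rationalTateRep_holds`: the generic
   `Literature.NumberTheory.EllipticCurves.continuous_rationalTateRepresentation`
   (`TateModuleContinuityProofs`: pull the action back along the open quotient map `ℚ_ℓⁿ → V_ℓ A`
   given by `ℤ_ℓ`-generators of `T_ℓ A`) needs exactly 3 and the discreteness of the `Γ_K`-module
   `A(K̄)` (`AbelianVariety.continuousSMul_geomPoints` of `AVGaloisModuleProofs`; a private copy
   `continuousSMul_geomPoints'` is proved below so that this file does not depend on that sibling,
   from the open stabilisers of points of schemes locally of finite type). Finite generation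
   of `T_ℓ A` is genuinely needed: for a discrete `Γ`-module whose Tate module is not finitely
   generated, orbit maps into `ℚ_ℓ ⊗ T_ℓ` need not be continuous for the `ℚ_ℓ`-module topology.

## Design

Theorems only (no definitions, instances or named facts); `noncomputable section`, `universe u`
as in the parent files. Declarations about `AbelianVariety` are deliberate dot-notation extensions
into `Literature.AlgebraicGeometry.Motives`, declared with absolute names as in the parent file.
-/

noncomputable section

open CategoryTheory AlgebraicGeometry Topology

universe u

namespace Literature.NumberTheory.DiophantineGeometry

/-! ### Open stabilisers for points of schemes locally of finite type (local copies)

Public versions: `AlgPoints.exists_finset_forall_smul_eq`, `AbelianVariety.isOpen_coe_stabilizer`,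
`AbelianVariety.continuousSMul_geomPoints` of `AVGaloisModuleProofs` (not imported here). -/

section AlgPoints

open Literature.AlgebraicGeometry.Motives (AlgPoints SchemeOver)
open Literature.AlgebraicGeometry.Motives.AlgPoints

variable {k : Type u} [Field k] {K : Type u} [Field K] [Algebra k K]

/-- Affine piece: a morphism `g : Spec K → A ≅ Spec k[s]` over `k`, `K/k` algebraic, is fixed by
`Gal(K/E)` for the finite extension `E = k(ψ(s))`, `g = Spec ψ` (Serre, *Galois Cohomology*,
II.§1.1, Remarque 2; Hartshorne II Ex. 2.7, Ex. 4.7). [cite: SerreGaloisCohomology1997, II.§1.1 Remarque 2] -/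
private theorem exists_finiteDimensional_forall_specMap_comp_eq
    [Algebra.IsIntegral k K] {A : Scheme.{u}} [IsAffine A] (h : A ⟶ Spec (CommRingCat.of k))
    [LocallyOfFiniteType h] (g : Spec (CommRingCat.of K) ⟶ A)
    (hg : g ≫ h = Spec.map (CommRingCat.ofHom (algebraMap k K))) :
    ∃ E : IntermediateField k K, FiniteDimensional k E ∧
      ∀ σ : K ≃ₐ[k] K, σ ∈ E.fixingSubgroup →
        Spec.map (CommRingCat.ofHom (σ : K →+* K)) ≫ g = g := by
  classical
  obtain ⟨φ, hφ⟩ :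
      ∃ φ : CommRingCat.of k ⟶ Γ(A, ⊤), Spec.map φ = A.isoSpec.inv ≫ h :=
    ⟨_, Spec.map_preimage _⟩
  have hft : φ.hom.FiniteType := by
    have : LocallyOfFiniteType (Spec.map φ) := by rw [hφ]; infer_instance
    exact (HasRingHomProperty.Spec_iff (P := @LocallyOfFiniteType)).mp this
  letI : Algebra k Γ(A, ⊤) := φ.hom.toAlgebra
  obtain ⟨s, hs⟩ : (⊤ : Subalgebra k Γ(A, ⊤)).FG := hft.out
  obtain ⟨ψ, hψ⟩ :
      ∃ ψ : Γ(A, ⊤) ⟶ CommRingCat.of K, Spec.map ψ = g ≫ A.isoSpec.hom :=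
    ⟨_, Spec.map_preimage _⟩
  have hcomm : φ ≫ ψ = CommRingCat.ofHom (algebraMap k K) := by
    apply Spec.map_injective
    simp only [Spec.map_comp, hψ, hφ, Category.assoc, Iso.hom_inv_id_assoc, hg]
  have hc : ∀ c : k, ψ.hom (φ.hom c) = algebraMap k K c := fun c => by
    simpa using congrArg (fun f : CommRingCat.of k ⟶ CommRingCat.of K => f.hom c) hcomm
  let ψ' : Γ(A, ⊤) →ₐ[k] K := ⟨ψ.hom, hc⟩
  let S : Set K := (fun a => ψ.hom a) '' (s : Set Γ(A, ⊤))
  refine ⟨IntermediateField.adjoin k S,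
    IntermediateField.finiteDimensional_adjoin fun z _ => Algebra.IsIntegral.isIntegral z, ?_⟩
  intro σ hσ
  rw [IntermediateField.mem_fixingSubgroup_iff] at hσ
  have heq : (σ : K →ₐ[k] K).comp ψ' = ψ' :=
    AlgHom.ext_of_adjoin_eq_top hs fun a ha =>
      hσ _ (IntermediateField.subset_adjoin k S ⟨a, ha, rfl⟩)
  have hfix : ∀ a, σ (ψ.hom a) = ψ.hom a := fun a => DFunLike.congr_fun heq a
  have hψσ : ψ ≫ CommRingCat.ofHom (σ : K →+* K) = ψ :=
    CommRingCat.hom_ext (RingHom.ext fun a => by simpa using hfix a)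
  rw [← cancel_mono A.isoSpec.hom, Category.assoc, ← hψ, ← Spec.map_comp, hψσ]

/-- Points of a `k`-scheme locally of finite type over an algebraic extension `K/k` have open
stabilisers in `Aut(K/k)` (Krull topology): factor through an affine open (`IsOpenImmersion.lift`)
and use the affine piece. Serre, *Galois Cohomology*, II.§1.1, Remarque 2.
[cite: SerreGaloisCohomology1997, II.§1.1 Remarque 2] -/
private theorem isOpen_stabilizer_algEquiv
    [Algebra.IsIntegral k K] (X : SchemeOver k) [LocallyOfFiniteType X.hom] (P : AlgPoints X K) :
    IsOpen ((MulAction.stabilizer (K ≃ₐ[k] K) P : Subgroup (K ≃ₐ[k] K)) : Set (K ≃ₐ[k] K)) := by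
  let p : Spec (CommRingCat.of K) ⟶ X.left := P.left
  let 𝒰 : X.left.OpenCover := X.left.affineCover
  let x₀ : ↥(Spec (CommRingCat.of K)) := default
  let i : 𝒰.I₀ := 𝒰.idx (p x₀)
  have hsub : Set.range p ⊆ Set.range (𝒰.f i) := by
    rintro _ ⟨y, rfl⟩
    obtain rfl : x₀ = y := Subsingleton.elim _ _
    exact 𝒰.covers _
  obtain ⟨g, hg⟩ : ∃ g : Spec (CommRingCat.of K) ⟶ 𝒰.X i, g ≫ 𝒰.f i = p :=
    ⟨_, IsOpenImmersion.lift_fac (𝒰.f i) p hsub⟩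
  have hgk : g ≫ (𝒰.f i ≫ X.hom) = Spec.map (CommRingCat.ofHom (algebraMap k K)) := by
    rw [← Category.assoc, hg]
    exact Over.w P
  obtain ⟨E, hE, hfix⟩ :=
    exists_finiteDimensional_forall_specMap_comp_eq (𝒰.f i ≫ X.hom) g hgk
  haveI := hE
  refine Subgroup.isOpen_mono (H₁ := E.fixingSubgroup) ?_ E.fixingSubgroup_isOpen
  intro σ hσ
  rw [MulAction.mem_stabilizer_iff]
  apply Over.OverMorphism.ext
  change Spec.map (CommRingCat.ofHom (σ : K →+* K)) ≫ p = p
  rw [← hg, ← Category.assoc, hfix σ hσ]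

end AlgPoints

/-! ### Points of finite schemes over a field -/

section FiniteScheme

open Literature.AlgebraicGeometry.Motives (algebraMapΓ specHomEquivUnderHom underHomEquivAlgHom)

/-- **A finite scheme over a field has finitely many points in any field.** If `g : G → Spec K`
is a finite morphism and `L ⊇ K` is a field, the `L`-points of `G` over `K` (morphisms
`x : Spec L → G` with `x ≫ g = Spec (K → L)`) form a finite set: `G = Spec H` with `H` a finite
`K`-algebra (Mathlib `HasAffineProperty` for `IsFinite`), the points are the `K`-algebra maps
`H → L` (`specHomEquivUnderHom`, `underHomEquivAlgHom`), and a `K`-algebra map out of a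
finite-dimensional `H` into a domain is pinned down by finitely many root choices (Mathlib
`minpoly.AlgHom.fintype`). Görtz–Wedhorn II, proof of Prop. 27.188 (1) (points of the finite
`K`-scheme `X[n]`). [folklore] -/
theorem finite_specHom_of_isFinite {K : Type u} [Field K] {G : Scheme.{u}}
    (g : G ⟶ Spec (.of K)) [IsFinite g] (L : Type u) [Field L] [Algebra K L] :
    Finite {x : Spec (.of L) ⟶ G // x ≫ g = Spec.map (CommRingCat.ofHom (algebraMap K L))} := by
  obtain ⟨hG, hfin⟩ := (HasAffineProperty.iff_of_isAffine (P := @IsFinite)).mp ‹IsFinite g›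
  letI := (algebraMapΓ g).hom.toAlgebra
  haveI : Module.Finite K Γ(G, ⊤) := by
    have h : (algebraMapΓ g).hom.Finite := by
      rw [algebraMapΓ, CommRingCat.hom_comp]
      exact (RingHom.finite_respectsIso.cancel_left_isIso _ _).mpr hfin
    exact h
  exact Finite.of_equiv _
    ((specHomEquivUnderHom g L).trans (underHomEquivAlgHom (algebraMapΓ g) L)).symm

end FiniteScheme

/-! ### Finiteness of the `n`-torsion of an abelian variety -/

section AbelianVariety

open Literature.AlgebraicGeometry.Motives (AbelianVariety AlgPoints)
open Literature.AlgebraicGeometry.Motives.AbelianVariety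
open Literature.NumberTheory.EllipticCurves

variable {K : Type u} [Field K] (A : AbelianVariety K)

/-- `A(K̄)` is a discrete `Γ_K`-module: `Γ_K × A(K̄) → A(K̄)` is jointly continuous for the discrete
topology on `A(K̄)`, stabilisers being open (`isOpen_stabilizer_algEquiv`, `A → Spec K` being of
finite type; Mathlib `continuousSMul_iff_stabilizer_isOpen`). Local copy of
`AbelianVariety.continuousSMul_geomPoints` (`AVGaloisModuleProofs`). Serre, *Galois Cohomology*,
II.§1.1, Remarque 2. [cite: SerreGaloisCohomology1997, II.§1.1 Remarque 2] -/
private theorem continuousSMul_geomPoints' :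
    ContinuousSMul (Field.absoluteGaloisGroup K) A.geomPoints :=
  continuousSMul_iff_stabilizer_isOpen.2 fun P =>
    isOpen_stabilizer_algEquiv A.X (Additive.toMul P : A.Points (AlgebraicClosure K))

variable {A} in
/-- If `[n]_A = n • 𝟙 A` is an isogeny, the `n`-torsion `A[n](L)` is finite for every field
`L ⊇ K`: `A[n](L)` is the set of `L`-points over `K` of the kernel scheme `A[n] = Ker [n]_A`
(`torsionPoints_eq_kerPoints`, `Hom.kerPointsEquiv`), a finite `K`-scheme (base change of the
finite `[n]_A` along the unit section), which has finitely many `L`-points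
(`finite_specHom_of_isFinite`). Görtz–Wedhorn II, (27.35.2) and Cor. 27.177 (1); Mumford,
*Abelian Varieties*, §6, Application 3, Proposition p. 64 (`X_n` is finite).
[cite: GortzWedhorn2023, Cor. 27.177 (1) and (27.35.2)] -/
theorem _root_.Literature.AlgebraicGeometry.Motives.AbelianVariety.finite_torsionPoints_of_isIsogeny_zsmul
    {n : ℤ} (hiso : IsIsogeny (n • 𝟙 A)) (L : Type u) [Field L] [Algebra K L] :
    Finite (A.torsionPoints L n) := by
  haveI : IsFinite (Hom.toSchemeHom (n • 𝟙 A)) := hiso.2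
  haveI : IsFinite (Hom.kerToSpec (n • 𝟙 A)) := inferInstance
  haveI := finite_specHom_of_isFinite (Hom.kerToSpec (n • 𝟙 A)) L
  rw [torsionPoints_eq_kerPoints]
  exact Finite.of_equiv _ (Hom.kerPointsEquiv (n • 𝟙 A) L).symm

/-- **`A[n](L)` is finite for `n` invertible in `K`** and any field `L ⊇ K`: `[n]_A` is then an
isogeny (`isIsogeny_zsmul_id_of_cast_ne_zero` of `AbelianVarietyLie`: `Lie([n]) = n`, so `[n]_A`
is étale, and étale homomorphisms of abelian varieties are finite surjective — Görtz–Wedhorn II,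
Prop. 27.187), so `finite_torsionPoints_of_isIsogeny_zsmul` applies. Mumford, *Abelian
Varieties*, §6, Application 3, Proposition p. 64 (finiteness part, `char K ∤ n`).
[cite: MumfordAV1970, §6 Application 3 (Proposition p. 64)] -/
theorem _root_.Literature.AlgebraicGeometry.Motives.AbelianVariety.finite_torsionPoints_of_cast_ne_zero
    (L : Type u) [Field L] [Algebra K L] (n : ℤ) (hn : (n : K) ≠ 0) :
    Finite (A.torsionPoints L n) :=
  finite_torsionPoints_of_isIsogeny_zsmul (isIsogeny_zsmul_id_of_cast_ne_zero n hn) L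

/-- **The geometric `n`-torsion `A[n] = A(K̄)[n]` is finite for `n` invertible in `K`**
(`finite_torsionPoints_of_cast_ne_zero` at `L = K̄`, transported along `geomTorsionEquiv`).
Mumford, *Abelian Varieties*, §6, Application 3, Proposition p. 64; Serre–Tate 1968, §1, p. 493
(`A_m` is finite, indeed free of rank `2 dim A` over `ℤ/m`). [cite: MumfordAV1970, §6 Application 3 (Proposition p. 64)] -/
theorem _root_.Literature.AlgebraicGeometry.Motives.AbelianVariety.finite_geomTorsion_of_cast_ne_zero
    (n : ℤ) (hn : (n : K) ≠ 0) : Finite (A.geomTorsion n) :=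
  haveI := finite_torsionPoints_of_cast_ne_zero A (AlgebraicClosure K) n hn
  Finite.of_equiv _ (A.geomTorsionEquiv n).symm

/-! ### `T_ℓ A` is finitely generated and free over `ℤ_ℓ` for `ℓ ≠ char K` -/

variable (ℓ : ℕ) [Fact ℓ.Prime]

/-- **`T_ℓ A` is a finitely generated `ℤ_ℓ`-module for `ℓ` invertible in `K`**: `A[ℓ](K̄)` is
finite (`finite_geomTorsion_of_cast_ne_zero`) and a Tate module `T_ℓ M` with `M[ℓ]` finite is
finitely generated over `ℤ_ℓ` (`TateModule.finite_of_finite_torsionBy`: Nakayama for the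
`ℓ`-adically separated `T_ℓ M` with `T_ℓ M / ℓ ↪ M[ℓ]`). This is the named fact
`module_finite_tateModule A ℓ` for `ℓ ≠ char K` (the fact itself has no restriction on `ℓ`; see
`module_finite_tateModule_of_isIsogeny_zsmul_id` for `ℓ = char K`). Mumford, *Abelian Varieties*,
§19, p. 171; Serre–Tate 1968, §1, p. 493. [cite: MumfordAV1970, §19 p. 171] -/
theorem _root_.Literature.AlgebraicGeometry.Motives.AbelianVariety.module_finite_tateModule_of_cast_ne_zero
    (hℓ : (ℓ : K) ≠ 0) : Module.Finite ℤ_[ℓ] (A.tateModule ℓ) :=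
  TateModule.finite_of_finite_torsionBy
    (finite_geomTorsion_of_cast_ne_zero A (ℓ : ℤ) (by exact_mod_cast hℓ))

/-- **Discharge of the named fact `AbelianVariety.module_free_tateModule`** (Mumford, *Abelian
Varieties*, §19, p. 171: `T_ℓ A ≅ ℤ_ℓ^{2g}` for `ℓ ≠ char K`; Serre–Tate 1968, §1, p. 493: "a free
module [...] over the ring `Z_l`"): for `ℓ` invertible in `K`, `T_ℓ A` is a free `ℤ_ℓ`-module —
`A[ℓ](K̄)` is finite (`finite_geomTorsion_of_cast_ne_zero`), so `T_ℓ A` is finitely generated and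
torsion-free over the PID `ℤ_ℓ` (`TateModule.free_of_finite_torsionBy`). (The rank `2g` is the
separate named fact `finrank_tateModule_eq`, which needs `#A[ℓⁿ](K̄) = ℓ^{2gn}`.)
[cite: MumfordAV1970, §19 p. 171] -/
theorem _root_.Literature.AlgebraicGeometry.Motives.AbelianVariety.module_free_tateModule_holds :
    A.module_free_tateModule ℓ := fun hℓ =>
  TateModule.free_of_finite_torsionBy
    (finite_geomTorsion_of_cast_ne_zero A (ℓ : ℤ) (by exact_mod_cast hℓ))

/-! ### Continuity of `Γ_K × V_ℓ A → V_ℓ A` -/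

/-- **`continuous_rationalTateRep` from finite generation of `T_ℓ A`.** If `T_ℓ A` is a finitely
generated `ℤ_ℓ`-module then `Γ_K × V_ℓ A → V_ℓ A` is jointly continuous for the `ℚ_ℓ`-module
topology on `V_ℓ A = ℚ_ℓ ⊗ T_ℓ A` (any prime `ℓ`): the generic
`Literature.NumberTheory.EllipticCurves.continuous_rationalTateRepresentation` (pull back along the
open quotient map `ℚ_ℓⁿ → V_ℓ A` given by `ℤ_ℓ`-generators) applied to the discrete `Γ_K`-module
`A(K̄)` (`continuousSMul_geomPoints'`). Serre, *Abelian ℓ-adic representations*,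
Ch. I §1.2, Example 2. [cite: SerreAbelianLadic1968, Ch. I §1.2 Example 2] -/
theorem _root_.Literature.AlgebraicGeometry.Motives.AbelianVariety.continuous_rationalTateRep_of_module_finite
    (hfin : Module.Finite ℤ_[ℓ] (A.tateModule ℓ)) :
    Continuous fun p : Field.absoluteGaloisGroup K × A.rationalTateModule ℓ ↦
      A.rationalTateRep ℓ p.1 p.2 := by
  haveI := continuousSMul_geomPoints' A
  haveI := hfin
  exact continuous_rationalTateRepresentation ℓ

/-- **Discharge of the named fact `AbelianVariety.continuous_rationalTateRep`** (Serre–Tate, *Good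
reduction of abelian varieties*, §1, p. 493: `Gal(K_s/K)` acts continuously on `T_l(A)` and
`V_l(A) = T_l(A) ⊗ Q_l`, the `l`-adic representation `ρ_l`, `l ≠ char K`; Serre, *Abelian ℓ-adic
representations*, Ch. I §1.1–1.2, Example 2: `V_ℓ(A)` "is an `ℓ`-adic representation"): for `ℓ`
invertible in `K`, the Galois action `Γ_K × V_ℓ A → V_ℓ A` is jointly continuous for the Krull
topology on `Γ_K` and the `ℚ_ℓ`-module topology on `V_ℓ A`. Proof: `T_ℓ A` is finitely generated
over `ℤ_ℓ` (`module_finite_tateModule_of_cast_ne_zero`: `A[ℓ](K̄)` is finite because `[ℓ]_A` is an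
isogeny) and `A(K̄)` is a discrete `Γ_K`-module, so `continuous_rationalTateRep_of_module_finite`
applies. [cite: SerreAbelianLadic1968, Ch. I §1.2 Example 2] -/
theorem _root_.Literature.AlgebraicGeometry.Motives.AbelianVariety.continuous_rationalTateRep_holds :
    A.continuous_rationalTateRep ℓ := fun hℓ =>
  continuous_rationalTateRep_of_module_finite A ℓ (module_finite_tateModule_of_cast_ne_zero A ℓ hℓ)

/-! ### All primes, from `[n]_A` being an isogeny for every `n ≠ 0` (theorem of the cube) -/

variable {A} in
/-- If `[ℓ]_A` is an isogeny then `T_ℓ A` is a finitely generated `ℤ_ℓ`-module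
(`finite_torsionPoints_of_isIsogeny_zsmul` and `TateModule.finite_of_finite_torsionBy`). Mumford,
*Abelian Varieties*, §19 p. 171, and §15 p. 147 for `ℓ = char K`. [cite: MumfordAV1970, §19 p. 171 and §15 p. 147] -/
theorem _root_.Literature.AlgebraicGeometry.Motives.AbelianVariety.module_finite_tateModule_of_isIsogeny_zsmul
    (hiso : IsIsogeny ((ℓ : ℤ) • 𝟙 A)) : Module.Finite ℤ_[ℓ] (A.tateModule ℓ) :=
  haveI := finite_torsionPoints_of_isIsogeny_zsmul hiso (AlgebraicClosure K)
  TateModule.finite_of_finite_torsionBy (Finite.of_equiv _ (A.geomTorsionEquiv (ℓ : ℤ)).symm)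

/-- **Reduction of the named fact `module_finite_tateModule A ℓ` (every prime `ℓ`, including
`ℓ = char K`) to `isIsogeny_zsmul_id A`** (`[n]_A` is an isogeny for all `n ≠ 0`; Görtz–Wedhorn
II, Prop. 27.186 — theorem of the cube; for `char K ∤ n` it is the theorem
`isIsogeny_zsmul_id_of_cast_ne_zero`): then `A[ℓ](K̄)` is finite and `T_ℓ A` is finitely
generated (`module_finite_tateModule_of_isIsogeny_zsmul`). Mumford, *Abelian Varieties*, §19
p. 171, §15 p. 147. [cite: MumfordAV1970, §19 p. 171 and §15 p. 147] -/
theorem _root_.Literature.AlgebraicGeometry.Motives.AbelianVariety.module_finite_tateModule_of_isIsogeny_zsmul_id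
    (h : A.isIsogeny_zsmul_id) : A.module_finite_tateModule ℓ :=
  module_finite_tateModule_of_isIsogeny_zsmul ℓ
    (h ℓ (by exact_mod_cast (Fact.out : ℓ.Prime).ne_zero))

/-- In characteristic zero `T_ℓ A` is finitely generated over `ℤ_ℓ` for every prime `ℓ`: the named
fact `module_finite_tateModule A ℓ` holds outright (`module_finite_tateModule_of_cast_ne_zero`).
Mumford, *Abelian Varieties*, §19 p. 171. [cite: MumfordAV1970, §19 p. 171] -/
theorem _root_.Literature.AlgebraicGeometry.Motives.AbelianVariety.module_finite_tateModule_holds_of_charZero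
    [CharZero K] : A.module_finite_tateModule ℓ :=
  module_finite_tateModule_of_cast_ne_zero A ℓ (by exact_mod_cast (Fact.out : ℓ.Prime).ne_zero)

end AbelianVariety

/-! ### `dim_{ℚ_ℓ} V_ℓ A = rank_{ℤ_ℓ} T_ℓ A` for `ℓ ≠ char K`: the named facts `finrank_rationalTateModule_eq` and `finrank_tateModule_eq` are equivalent -/

section FinrankBridge

open Literature.AlgebraicGeometry.Motives (AbelianVariety)
open Literature.AlgebraicGeometry.Motives.AbelianVariety
open Literature.NumberTheory.EllipticCurves

variable {K : Type u} [Field K] (A : AbelianVariety K) (ℓ : ℕ) [Fact ℓ.Prime]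

/-- **`dim_{ℚ_ℓ} V_ℓ A = rank_{ℤ_ℓ} T_ℓ A` for `ℓ` invertible in `K`, unconditionally**:
`V_ℓ A = ℚ_ℓ ⊗_{ℤ_ℓ} T_ℓ A` by definition (`Literature.NumberTheory.EllipticCurves.RationalTateModule`)
and `T_ℓ A` is a free `ℤ_ℓ`-module (`module_free_tateModule_holds`), so the rank is preserved under
base change (Mathlib `Module.finrank_baseChange`). Serre–Tate 1968, §1, p. 493 (`T_l(A)` free over
`ℤ_l`, `V_l(A) = T_l(A) ⊗ ℚ_l`); Silverman, *AEC*, Remark III.7.2 for elliptic curves (the tree's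
`WeierstrassCurve.finrank_rationalTateModule_eq_finrank_tateModule`). [folklore] -/
theorem _root_.Literature.AlgebraicGeometry.Motives.AbelianVariety.finrank_rationalTateModule_eq_finrank_tateModule
    (hℓ : (ℓ : K) ≠ 0) :
    Module.finrank ℚ_[ℓ] (A.rationalTateModule ℓ) = Module.finrank ℤ_[ℓ] (A.tateModule ℓ) := by
  haveI : Module.Free ℤ_[ℓ] (A.tateModule ℓ) := module_free_tateModule_holds A ℓ hℓ
  change Module.finrank ℚ_[ℓ] (TensorProduct ℤ_[ℓ] ℚ_[ℓ] (TateModule A.geomPoints ℓ)) = _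
  rw [Module.finrank_baseChange]

/-- **The named fact `finrank_rationalTateModule_eq A ℓ` (`dim_{ℚ_ℓ} V_ℓ A = 2 dim A` for `ℓ`
invertible in `K`; Mumford, *Abelian Varieties*, §19, p. 172) follows from the named fact
`finrank_tateModule_eq A ℓ` (`rank_{ℤ_ℓ} T_ℓ A = 2 dim A`; Serre–Tate 1968, §1, p. 493; Görtz–Wedhorn
II, Remark 27.193, p. 892: "If `ℓ ≠ char(k)`, then `T_ℓ(X)` is a free `ℤ_ℓ`-module of rank `2g`")**,
by `finrank_rationalTateModule_eq_finrank_tateModule`. Hence a discharge `finrank_tateModule_eq_holds`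
gives `finrank_rationalTateModule_eq_holds := finrank_rationalTateModule_eq_of_finrank_tateModule_eq A ℓ
(finrank_tateModule_eq_holds A ℓ)`; no separate argument is needed for `V_ℓ`.
[cite: SerreTate1968, §1 p. 493] [cite: MumfordAV1970, §19 p. 172] -/
theorem _root_.Literature.AlgebraicGeometry.Motives.AbelianVariety.finrank_rationalTateModule_eq_of_finrank_tateModule_eq
    (h : A.finrank_tateModule_eq ℓ) : A.finrank_rationalTateModule_eq ℓ := fun hℓ =>
  (A.finrank_rationalTateModule_eq_finrank_tateModule ℓ hℓ).trans (h hℓ)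

/-- Conversely, the named fact `finrank_tateModule_eq A ℓ` (`rank_{ℤ_ℓ} T_ℓ A = 2 dim A` for `ℓ`
invertible in `K`; Serre–Tate 1968, §1, p. 493) follows from `finrank_rationalTateModule_eq A ℓ`
(`dim_{ℚ_ℓ} V_ℓ A = 2 dim A`; Mumford §19, p. 172), by
`finrank_rationalTateModule_eq_finrank_tateModule`. [cite: SerreTate1968, §1 p. 493] -/
theorem _root_.Literature.AlgebraicGeometry.Motives.AbelianVariety.finrank_tateModule_eq_of_finrank_rationalTateModule_eq
    (h : A.finrank_rationalTateModule_eq ℓ) : A.finrank_tateModule_eq ℓ := fun hℓ =>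
  (A.finrank_rationalTateModule_eq_finrank_tateModule ℓ hℓ).symm.trans (h hℓ)

/-- **The named facts `finrank_rationalTateModule_eq A ℓ` (`dim_{ℚ_ℓ} V_ℓ A = 2 dim A`) and
`finrank_tateModule_eq A ℓ` (`rank_{ℤ_ℓ} T_ℓ A = 2 dim A`) are equivalent** (for every abelian
variety `A` and prime `ℓ`; both quantify over `ℓ` invertible in `K`), since
`dim_{ℚ_ℓ} V_ℓ A = rank_{ℤ_ℓ} T_ℓ A` unconditionally
(`finrank_rationalTateModule_eq_finrank_tateModule`). Serre–Tate 1968, §1, p. 493; Mumford §19,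
pp. 171–172. [cite: SerreTate1968, §1 p. 493] -/
theorem _root_.Literature.AlgebraicGeometry.Motives.AbelianVariety.finrank_rationalTateModule_eq_iff_finrank_tateModule_eq :
    A.finrank_rationalTateModule_eq ℓ ↔ A.finrank_tateModule_eq ℓ :=
  ⟨A.finrank_tateModule_eq_of_finrank_rationalTateModule_eq ℓ,
    A.finrank_rationalTateModule_eq_of_finrank_tateModule_eq ℓ⟩

end FinrankBridge

end Literature.NumberTheory.DiophantineGeometry
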